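import Literature.NumberTheory.EllipticCurves.BDPAnticyclotomicPAdicLFunction
import Mathlib.Analysis.SpecificLimits.Normed
import Mathlib.Analysis.Normed.Group.Ultra
import Mathlib.Data.Fintype.Pigeonhole
import Mathlib.Algebra.Algebra.Operations
import Mathlib.LinearAlgebra.Finsupp.LinearCombination
import HarnessLib

/-!
# Units of `R₀ = unrIntegers p ⊂ ℂ_p`: an element of `R₀` of norm `1` is invertible IN `R₀`

`R₀ = unrIntegers p` (`Literature/…/BDPAnticyclotomicPAdicLFunction.lean` §2) is the closure in
`ℂ_p` of the subring generated by the roots of unity of order prime to `p` — "the completion of the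
ring of integers of the maximal unramified extension of `ℚ_p`" (Castella 2018 §3; Castella–Hsieh's
`𝒲 = W(𝔽̄_p)`; Serre, *Local Fields* IV §4, Prop. 16 and Cor. 2: `K_nr = K(μ_m : p ∤ m)`,
`A_{K_n} = A_K[ζ]`). This file proves, by ELEMENTARY means (no local field theory), the first of the
valuation-ring properties of `R₀` used by an `R₀`-descent of coefficients:

* `unrIntegers.inv_mem_of_norm_eq_one`: `b ∈ R₀`, `‖b‖ = 1` ⟹ `b⁻¹ ∈ R₀`;
* `unrIntegers.isUnit_iff_norm_eq_one`: for `x : R₀`, `IsUnit x ↔ ‖x‖ = 1`;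
* `exists_mem_spanRoots_of_mem_closure`: the normal form `Subring.closure (μ_{p'}) = ⋃_M Span_ℤ(μ_M)`.

PROOF (pigeonhole; Serre's Prop. 16 proves much more). Every element of the generated subring lies
in the `ℤ`-span `Z_M` of the finite set `μ_M ⊂ ℂ_p` of `M`-th roots of unity for some `M` prime to
`p` (`exists_mem_spanRoots_of_mem_closure`; `Z_M` is a ring since `μ_M · μ_M ⊆ μ_M`). For `a ∈ Z_M`
with `‖a‖ = 1`, all powers `a^k` lie in `Z_M`; writing `a^k = Σ_{t ∈ μ_M} c_t^{(k)} t` with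
`c^{(k)} ∈ ℤ^{μ_M}` and reducing the coefficient vectors mod `p`, the pigeonhole principle gives
`k₁ < k₂` with `c^{(k₁)} ≡ c^{(k₂)} (mod p)`, whence `a^{k₁} − a^{k₂} ∈ p · Z_M` has norm `≤ p⁻¹`
and, dividing by `‖a^{k₁}‖ = 1`, `‖1 − a^j‖ ≤ p⁻¹ < 1` for `j = k₂ − k₁ ≥ 1`
(`exists_norm_pow_sub_one_le`). The geometric series `Σ (1 − a^j)^i` then converges IN the closed
subring `R₀` of the complete field `ℂ_p` to `(a^j)⁻¹`, and `a⁻¹ = a^{j−1} · (a^j)⁻¹ ∈ R₀`. A general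
`b ∈ R₀` of norm `1` is a limit of such `a` (of norm `1`, ultrametric), and `a⁻¹ → b⁻¹`.

What this file does NOT prove: the other two valuation-ring facts about `R₀` (DISCRETENESS
`‖R₀ ∖ 0‖ ⊆ p^{−ℕ}`, i.e. that `ℚ_p(μ_m)`, `p ∤ m`, is unramified; and `Frac R₀ ∩ {‖·‖ ≤ 1} = R₀`),
which rest on the separability of `X^m − 1` mod `p`.

References: [SerreLocalFields1979] J.-P. Serre, *Local Fields*, GTM 67, Ch. II §5 Thm. 3 and Ch. IV §4,
Prop. 16, Cor. 2 (the object `A_{K̂_nr} = W(𝔽̄_p)`); [Castella2018] F. Castella, Camb. J. Math. 6 (2018), §3 p. 9 (the name `R₀`).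
The statements of this file are folklore.
-/

noncomputable section

open scoped Classical Pointwise
open Filter Topology Polynomial

namespace Literature.NumberTheory.EllipticCurves

variable {p : ℕ} [hp : Fact p.Prime]

/-! ### §1. Norm bookkeeping in `ℂ_p` -/

/-- `‖p‖ = p⁻¹` in `ℂ_p`. [folklore] -/
private theorem PadicComplex.norm_natCast_self : ‖(p : ℂ_[p])‖ = (p : ℝ)⁻¹ := by
  rw [← map_natCast (algebraMap ℚ_[p] ℂ_[p]) p]
  exact (PadicComplex.norm_extends' (p := p) (p : ℚ_[p])).trans Padic.norm_p

/-- `‖p‖ < 1` in `ℂ_p`. [folklore] -/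
private theorem PadicComplex.norm_natCast_self_lt_one : ‖(p : ℂ_[p])‖ < 1 := by
  rw [PadicComplex.norm_natCast_self]
  exact inv_lt_one_of_one_lt₀ (by exact_mod_cast hp.out.one_lt)

/-- Integers have norm `≤ 1` in `ℂ_p`. [folklore] -/
private theorem PadicComplex.norm_intCast_le_one (c : ℤ) : ‖(c : ℂ_[p])‖ ≤ 1 := by
  rw [← map_intCast (algebraMap ℚ_[p] ℂ_[p]) c]
  exact (PadicComplex.norm_extends' (p := p) (c : ℚ_[p])).le.trans (Padic.norm_int_le_one c)

/-- A root of unity in `ℂ_p` has norm `1`. [folklore] -/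
private theorem PadicComplex.norm_eq_one_of_pow_eq_one {z : ℂ_[p]} {n : ℕ} (hn : 0 < n) (hz : z ^ n = 1) :
    ‖z‖ = 1 := by
  have h : ‖z‖ ^ n = 1 := by rw [← norm_pow, hz, norm_one]
  exact (pow_eq_one_iff_of_nonneg (norm_nonneg z) hn.ne').mp h

/-- In an ultrametric normed group: `‖a − b‖ < ‖b‖ ⟹ ‖a‖ = ‖b‖`. [folklore] -/
private theorem PadicComplex.norm_eq_of_norm_sub_lt {a b : ℂ_[p]} (h : ‖a - b‖ < ‖b‖) : ‖a‖ = ‖b‖ := by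
  have h1 : ‖a‖ ≤ ‖b‖ := by
    calc ‖a‖ = ‖(a - b) + b‖ := by rw [sub_add_cancel]
      _ ≤ max ‖a - b‖ ‖b‖ := IsUltrametricDist.norm_add_le_max _ _
      _ = ‖b‖ := max_eq_right h.le
  have h2 : ‖b‖ ≤ ‖a‖ := by
    by_contra hle
    have hlt : ‖a‖ < ‖b‖ := lt_of_not_ge hle
    have : ‖b‖ < ‖b‖ := by
      calc ‖b‖ = ‖(b - a) + a‖ := by rw [sub_add_cancel]
        _ ≤ max ‖b - a‖ ‖a‖ := IsUltrametricDist.norm_add_le_max _ _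
        _ < ‖b‖ := max_lt (by rwa [norm_sub_rev]) hlt
    exact lt_irrefl _ this
  exact le_antisymm h1 h2

/-! ### §2. The `ℤ`-span `Z_M = Submodule.span ℤ μ_M` of the `M`-th roots of unity

No definition is introduced: `Z_M` is written `Submodule.span ℤ (nthRootsFinset M (1 : ℂ_[p]))`. -/

/-- `t ∈ μ_M ↔ t^M = 1`. [folklore] -/
private theorem mem_nthRootsFinset_one_iff {M : ℕ} (hM : 0 < M) {t : ℂ_[p]} :
    t ∈ nthRootsFinset M (1 : ℂ_[p]) ↔ t ^ M = 1 :=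
  Polynomial.mem_nthRootsFinset hM (1 : ℂ_[p])

/-- `μ_M · μ_M ⊆ μ_M`. [folklore] -/
private theorem nthRootsFinset_mul_subset {M : ℕ} (hM : 0 < M) :
    (nthRootsFinset M (1 : ℂ_[p]) : Set ℂ_[p]) * (nthRootsFinset M (1 : ℂ_[p]) : Set ℂ_[p])
      ⊆ (nthRootsFinset M (1 : ℂ_[p]) : Set ℂ_[p]) := by
  rintro _ ⟨s, hs, t, ht, rfl⟩
  rw [Finset.mem_coe, mem_nthRootsFinset_one_iff (p := p) hM] at hs ht ⊢
  rw [mul_pow, hs, ht, one_mul]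

/-- `Z_M` is closed under multiplication. [folklore] -/
private theorem mul_mem_spanRoots {M : ℕ} (hM : 0 < M) {x y : ℂ_[p]}
    (hx : x ∈ Submodule.span ℤ (nthRootsFinset M (1 : ℂ_[p]) : Set ℂ_[p]))
    (hy : y ∈ Submodule.span ℤ (nthRootsFinset M (1 : ℂ_[p]) : Set ℂ_[p])) :
    x * y ∈ Submodule.span ℤ (nthRootsFinset M (1 : ℂ_[p]) : Set ℂ_[p]) := by
  have h : Submodule.span ℤ (nthRootsFinset M (1 : ℂ_[p]) : Set ℂ_[p]) *
      Submodule.span ℤ (nthRootsFinset M (1 : ℂ_[p]) : Set ℂ_[p]) ≤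
      Submodule.span ℤ (nthRootsFinset M (1 : ℂ_[p]) : Set ℂ_[p]) := by
    rw [Submodule.span_mul_span]
    exact Submodule.span_mono (nthRootsFinset_mul_subset (p := p) hM)
  exact h (Submodule.mul_mem_mul hx hy)

/-- `1 ∈ Z_M`. [folklore] -/
private theorem one_mem_spanRoots {M : ℕ} (hM : 0 < M) :
    (1 : ℂ_[p]) ∈ Submodule.span ℤ (nthRootsFinset M (1 : ℂ_[p]) : Set ℂ_[p]) :=
  Submodule.subset_span (by
    rw [Finset.mem_coe, mem_nthRootsFinset_one_iff (p := p) hM, one_pow])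

/-- `Z_M` is closed under powers. [folklore] -/
private theorem pow_mem_spanRoots {M : ℕ} (hM : 0 < M) {x : ℂ_[p]}
    (hx : x ∈ Submodule.span ℤ (nthRootsFinset M (1 : ℂ_[p]) : Set ℂ_[p])) (k : ℕ) :
    x ^ k ∈ Submodule.span ℤ (nthRootsFinset M (1 : ℂ_[p]) : Set ℂ_[p]) := by
  induction k with
  | zero => simpa using one_mem_spanRoots hM
  | succ k ih => rw [pow_succ]; exact mul_mem_spanRoots hM ih hx

/-- `Z_M ⊆ Z_{M·M'}`. [folklore] -/
private theorem spanRoots_le_mul {M M' : ℕ} (hM' : 0 < M') :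
    Submodule.span ℤ (nthRootsFinset M (1 : ℂ_[p]) : Set ℂ_[p]) ≤
      Submodule.span ℤ (nthRootsFinset (M * M') (1 : ℂ_[p]) : Set ℂ_[p]) := by
  rcases Nat.eq_zero_or_pos M with rfl | hM
  · simp [Polynomial.nthRootsFinset_zero]
  refine Submodule.span_mono fun t ht ↦ ?_
  rw [Finset.mem_coe, mem_nthRootsFinset_one_iff (p := p) hM] at ht
  rw [Finset.mem_coe, mem_nthRootsFinset_one_iff (p := p) (Nat.mul_pos hM hM'), pow_mul, ht,
    one_pow]

/-- `Z_M ⊆ R₀` for `M` prime to `p`. [folklore] -/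
private theorem spanRoots_le_unrIntegers {M : ℕ} (hM : 0 < M) (hpM : ¬ p ∣ M) {x : ℂ_[p]}
    (hx : x ∈ Submodule.span ℤ (nthRootsFinset M (1 : ℂ_[p]) : Set ℂ_[p])) :
    x ∈ unrIntegers p := by
  induction hx using Submodule.span_induction with
  | mem t ht =>
    rw [Finset.mem_coe, mem_nthRootsFinset_one_iff (p := p) hM] at ht
    exact mem_unrIntegers_of_pow_eq_one hM hpM ht
  | zero => exact zero_mem _
  | add x y _ _ hx hy => exact add_mem hx hy
  | smul c x _ hx => rw [zsmul_eq_mul]; exact mul_mem (intCast_mem_unrIntegers c) hx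

/-- A `ℤ`-combination of `M`-th roots of unity has norm `≤ 1`. [folklore] -/
private theorem norm_sum_zsmul_roots_le_one {M : ℕ} (hM : 0 < M) (f : ℂ_[p] → ℤ) :
    ‖∑ t ∈ nthRootsFinset M (1 : ℂ_[p]), f t • t‖ ≤ 1 := by
  refine IsUltrametricDist.norm_sum_le_of_forall_le_of_nonneg zero_le_one fun t ht ↦ ?_
  rw [mem_nthRootsFinset_one_iff (p := p) hM] at ht
  rw [zsmul_eq_mul, norm_mul, PadicComplex.norm_eq_one_of_pow_eq_one hM ht, mul_one]
  exact PadicComplex.norm_intCast_le_one _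

/-- Elements of `Z_M` have norm `≤ 1`. [folklore] -/
private theorem norm_le_one_of_mem_spanRoots {M : ℕ} (hM : 0 < M) {x : ℂ_[p]}
    (hx : x ∈ Submodule.span ℤ (nthRootsFinset M (1 : ℂ_[p]) : Set ℂ_[p])) : ‖x‖ ≤ 1 := by
  obtain ⟨f, -, rfl⟩ := Submodule.mem_span_finset.mp hx
  exact norm_sum_zsmul_roots_le_one hM f

/-- **Directedness / normal form**: every element of the subring of `ℂ_p` generated by the roots of
unity of order prime to `p` lies in `Z_M` for some `M > 0` prime to `p` (the ring-level shadow of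
"`K_nr` is obtained by adjoining to `K` all the roots of unity of order prime to `p`").
[cite: SerreLocalFields1979, Ch. IV §4, Cor. 2 to Prop. 16] -/
theorem exists_mem_spanRoots_of_mem_closure {x : ℂ_[p]}
    (hx : x ∈ Subring.closure {ζ : ℂ_[p] | ∃ m : ℕ, 0 < m ∧ ¬ p ∣ m ∧ ζ ^ m = 1}) :
    ∃ M : ℕ, 0 < M ∧ ¬ p ∣ M ∧
      x ∈ Submodule.span ℤ (nthRootsFinset M (1 : ℂ_[p]) : Set ℂ_[p]) := by
  have hp' : p.Prime := hp.out
  induction hx using Subring.closure_induction with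
  | mem ζ hζ =>
    obtain ⟨m, hm, hpm, hζm⟩ := hζ
    exact ⟨m, hm, hpm, Submodule.subset_span (by
      rw [Finset.mem_coe, mem_nthRootsFinset_one_iff (p := p) hm, hζm])⟩
  | zero => exact ⟨1, one_pos, hp'.one_lt.ne' ∘ Nat.dvd_one.mp, zero_mem _⟩
  | one => exact ⟨1, one_pos, hp'.one_lt.ne' ∘ Nat.dvd_one.mp, one_mem_spanRoots one_pos⟩
  | add x y _ _ hx hy =>
    obtain ⟨M, hM, hpM, hxM⟩ := hx
    obtain ⟨M', hM', hpM', hyM⟩ := hy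
    refine ⟨M * M', Nat.mul_pos hM hM', fun h ↦ (hp'.dvd_mul.mp h).elim hpM hpM',
      add_mem ?_ ?_⟩
    · exact spanRoots_le_mul hM' hxM
    · rw [mul_comm]; exact spanRoots_le_mul hM hyM
  | neg x _ hx =>
    obtain ⟨M, hM, hpM, hxM⟩ := hx
    exact ⟨M, hM, hpM, neg_mem hxM⟩
  | mul x y _ _ hx hy =>
    obtain ⟨M, hM, hpM, hxM⟩ := hx
    obtain ⟨M', hM', hpM', hyM⟩ := hy
    refine ⟨M * M', Nat.mul_pos hM hM', fun h ↦ (hp'.dvd_mul.mp h).elim hpM hpM',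
      mul_mem_spanRoots (Nat.mul_pos hM hM') ?_ ?_⟩
    · exact spanRoots_le_mul hM' hxM
    · rw [mul_comm]; exact spanRoots_le_mul hM hyM

/-! ### §3. Pigeonhole: `‖a^j − 1‖ ≤ p⁻¹` for some `j ≥ 1` -/

/-- Two `ℤ`-combinations of `M`-th roots of unity whose coefficients agree mod `p` differ by an
element of norm `≤ p⁻¹`. [folklore] -/
private theorem norm_sub_le_of_forall_dvd_sub {M : ℕ} (hM : 0 < M) {f g : ℂ_[p] → ℤ}
    (h : ∀ t ∈ nthRootsFinset M (1 : ℂ_[p]), (p : ℤ) ∣ f t - g t) :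
    ‖∑ t ∈ nthRootsFinset M (1 : ℂ_[p]), f t • t - ∑ t ∈ nthRootsFinset M (1 : ℂ_[p]), g t • t‖
      ≤ (p : ℝ)⁻¹ := by
  choose! d hd using h
  have hrew : ∑ t ∈ nthRootsFinset M (1 : ℂ_[p]), f t • t - ∑ t ∈ nthRootsFinset M (1 : ℂ_[p]), g t • t
      = (p : ℂ_[p]) * ∑ t ∈ nthRootsFinset M (1 : ℂ_[p]), d t • t := by
    rw [← Finset.sum_sub_distrib, Finset.mul_sum]
    refine Finset.sum_congr rfl fun t ht ↦ ?_
    rw [← sub_smul, hd t ht, zsmul_eq_mul, zsmul_eq_mul, Int.cast_mul, Int.cast_natCast,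
      mul_assoc]
  rw [hrew, norm_mul, PadicComplex.norm_natCast_self]
  exact mul_le_of_le_one_right (inv_nonneg.mpr (Nat.cast_nonneg p))
    (norm_sum_zsmul_roots_le_one hM d)

/-- **Pigeonhole.** For `a ∈ Z_M` with `‖a‖ = 1` there is `j ≥ 1` with `‖a^j − 1‖ ≤ p⁻¹`: the
mod-`p` coefficient vectors of the powers `a^k ∈ Z_M` range over a finite set. [folklore] -/
private theorem exists_norm_pow_sub_one_le {M : ℕ} (hM : 0 < M) {a : ℂ_[p]}
    (ha : a ∈ Submodule.span ℤ (nthRootsFinset M (1 : ℂ_[p]) : Set ℂ_[p])) (ha1 : ‖a‖ = 1) :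
    ∃ j : ℕ, 0 < j ∧ ‖a ^ j - 1‖ ≤ (p : ℝ)⁻¹ := by
  haveI : NeZero p := ⟨hp.out.ne_zero⟩
  set S := nthRootsFinset M (1 : ℂ_[p]) with hS
  -- integer coefficient vectors of the powers `a^k ∈ Z_M`
  have hcoef : ∀ k : ℕ, ∃ f : ℂ_[p] → ℤ, ∑ t ∈ S, f t • t = a ^ k := fun k ↦ by
    obtain ⟨f, -, hf⟩ := Submodule.mem_span_finset.mp (pow_mem_spanRoots hM ha k)
    exact ⟨f, hf⟩
  choose f hf using hcoef
  let F : ℕ → (S → ZMod p) := fun k t ↦ ((f k t : ℤ) : ZMod p)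
  obtain ⟨k₁, k₂, hne, hF⟩ := Finite.exists_ne_map_eq_of_infinite F
  -- arrange `k₁ < k₂`
  wlog hlt : k₁ < k₂ generalizing k₁ k₂
  · exact this k₂ k₁ hne.symm hF.symm (lt_of_le_of_ne (not_lt.mp hlt) hne.symm)
  have hdvd : ∀ t ∈ S, (p : ℤ) ∣ f k₁ t - f k₂ t := fun t ht ↦ by
    have h := congrFun hF ⟨t, ht⟩
    simp only [F] at h
    exact (ZMod.intCast_eq_intCast_iff_dvd_sub _ _ _).mp h.symm
  have hnorm : ‖a ^ k₁ - a ^ k₂‖ ≤ (p : ℝ)⁻¹ := by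
    rw [← hf k₁, ← hf k₂]
    exact norm_sub_le_of_forall_dvd_sub hM hdvd
  refine ⟨k₂ - k₁, Nat.sub_pos_of_lt hlt, ?_⟩
  have hfac : a ^ k₁ - a ^ k₂ = a ^ k₁ * (1 - a ^ (k₂ - k₁)) := by
    rw [mul_sub, mul_one, pow_mul_pow_sub a hlt.le]
  rw [hfac, norm_mul, norm_pow, ha1, one_pow, one_mul] at hnorm
  rwa [norm_sub_rev]

/-! ### §4. Inversion inside `R₀` -/

/-- For `a ∈ Z_M` (`M` prime to `p`) of norm `1`: `a⁻¹ ∈ R₀` (geometric series in the closed subring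
`R₀` of the complete field `ℂ_p`). [folklore] -/
private theorem inv_mem_unrIntegers_of_mem_spanRoots {M : ℕ} (hM : 0 < M) (hpM : ¬ p ∣ M) {a : ℂ_[p]}
    (ha : a ∈ Submodule.span ℤ (nthRootsFinset M (1 : ℂ_[p]) : Set ℂ_[p]))
    (ha1 : ‖a‖ = 1) : a⁻¹ ∈ unrIntegers p := by
  obtain ⟨j, hj, hle⟩ := exists_norm_pow_sub_one_le hM ha ha1
  have haR : a ∈ unrIntegers p := spanRoots_le_unrIntegers hM hpM ha
  have hajR : a ^ j ∈ unrIntegers p := pow_mem haR j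
  set t : ℂ_[p] := 1 - a ^ j with ht
  have htR : t ∈ unrIntegers p := sub_mem (one_mem _) hajR
  have htlt : ‖t‖ < 1 := by
    rw [ht, norm_sub_rev]
    exact hle.trans_lt (by
      rw [← PadicComplex.norm_natCast_self (p := p)]; exact PadicComplex.norm_natCast_self_lt_one)
  have hsum : HasSum (fun n : ℕ ↦ t ^ n) (1 - t)⁻¹ := hasSum_geometric_of_norm_lt_one htlt
  have hinvj : (a ^ j)⁻¹ ∈ unrIntegers p := by
    have h1t : 1 - t = a ^ j := by rw [ht, sub_sub_cancel]
    rw [← h1t]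
    refine (isClosed_unrIntegers (p := p)).mem_of_tendsto hsum.tendsto_sum_nat
      (Eventually.of_forall fun n ↦ ?_)
    exact Subring.sum_mem _ fun i _ ↦ pow_mem htR i
  have ha0 : a ≠ 0 := fun h ↦ by simp [h] at ha1
  have hrew : a⁻¹ = a ^ (j - 1) * (a ^ j)⁻¹ := by
    have hj' : a ^ j = a ^ (j - 1) * a := by
      rw [← pow_succ, Nat.sub_add_cancel hj]
    rw [hj', mul_inv, ← mul_assoc, mul_comm (a ^ (j - 1)) ((a ^ (j - 1))⁻¹),
      inv_mul_cancel₀ (pow_ne_zero _ ha0), one_mul]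
  rw [hrew]
  exact mul_mem (pow_mem haR _) hinvj

/-- **An element of `R₀` of norm `1` is invertible in `R₀`** (`R₀ = A_{K̂_nr}` is the valuation ring
of `K̂_nr`, `K = ℚ_p`; its units are the elements of valuation `0`).
[cite: SerreLocalFields1979, Ch. IV §4, Prop. 16 and Cor. 2; Ch. II §5, Thm. 3] -/
theorem unrIntegers.inv_mem_of_norm_eq_one {b : ℂ_[p]} (hb : b ∈ unrIntegers p) (hb1 : ‖b‖ = 1) :
    b⁻¹ ∈ unrIntegers p := by
  have hb0 : b ≠ 0 := fun h ↦ by simp [h] at hb1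
  -- `b` is a limit of elements of the generated subring
  have hb' : b ∈ closure ((Subring.closure
      {ζ : ℂ_[p] | ∃ m : ℕ, 0 < m ∧ ¬ p ∣ m ∧ ζ ^ m = 1} : Subring ℂ_[p]) : Set ℂ_[p]) := hb
  obtain ⟨u, hu, hlim⟩ := mem_closure_iff_seq_limit.mp hb'
  have hinv : Tendsto (fun n ↦ (u n)⁻¹) atTop (𝓝 b⁻¹) := hlim.inv₀ hb0
  refine (isClosed_unrIntegers (p := p)).mem_of_tendsto hinv ?_
  have hev : ∀ᶠ n in atTop, ‖u n - b‖ < 1 := by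
    have := (tendsto_iff_norm_sub_tendsto_zero.mp hlim).eventually (gt_mem_nhds one_pos)
    exact this
  filter_upwards [hev] with n hn
  have hn1 : ‖u n‖ = 1 := (PadicComplex.norm_eq_of_norm_sub_lt (by rwa [hb1])).trans hb1
  obtain ⟨M, hM, hpM, huM⟩ := exists_mem_spanRoots_of_mem_closure (hu n)
  exact inv_mem_unrIntegers_of_mem_spanRoots hM hpM huM hn1

/-- **Units of `R₀` are exactly its elements of norm `1`** (`R₀` is the valuation ring of `K̂_nr`).
[cite: SerreLocalFields1979, Ch. IV §4, Prop. 16 and Cor. 2; Ch. II §5, Thm. 3] -/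
theorem unrIntegers.isUnit_iff_norm_eq_one (x : unrIntegers p) : IsUnit x ↔ ‖(x : ℂ_[p])‖ = 1 := by
  -- `R₀ ⊆ {‖·‖ ≤ 1}` (the `Summits`-side twin is `X11b.Halves.norm_le_one_of_mem_unrIntegers`;
  -- re-derived inline here because `Literature` cannot import `Summits`)
  have key : ∀ y : ℂ_[p], y ∈ unrIntegers p → ‖y‖ ≤ 1 := fun y hy ↦ by
    have hy' : y ∈ closure ((Subring.closure
        {ζ : ℂ_[p] | ∃ m : ℕ, 0 < m ∧ ¬ p ∣ m ∧ ζ ^ m = 1} : Subring ℂ_[p]) : Set ℂ_[p]) := hy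
    refine (isClosed_Iic.preimage continuous_norm).closure_subset_iff.mpr ?_ hy'
    intro z hz
    obtain ⟨M, hM, -, hzM⟩ := exists_mem_spanRoots_of_mem_closure hz
    exact norm_le_one_of_mem_spanRoots hM hzM
  constructor
  · rintro ⟨u, rfl⟩
    set a : ℝ := ‖((u.val : unrIntegers p) : ℂ_[p])‖ with ha
    set b : ℝ := ‖((u.inv : unrIntegers p) : ℂ_[p])‖ with hb
    have hmul : ((u.val : unrIntegers p) : ℂ_[p]) * ((u.inv : unrIntegers p) : ℂ_[p]) = 1 := by
      rw [← Subring.coe_mul, u.val_inv, Subring.coe_one]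
    have hprod : a * b = 1 := by rw [ha, hb, ← norm_mul, hmul, norm_one]
    have hle2 : b ≤ 1 := key _ u.inv.2
    refine le_antisymm (key _ u.val.2) ?_
    calc (1 : ℝ) = a * b := hprod.symm
      _ ≤ a * 1 := mul_le_mul_of_nonneg_left hle2 (norm_nonneg _)
      _ = a := mul_one a
  · intro h1
    have h0 : (x : ℂ_[p]) ≠ 0 := fun h ↦ by simp [h] at h1
    refine ⟨⟨x, ⟨(x : ℂ_[p])⁻¹, unrIntegers.inv_mem_of_norm_eq_one x.2 h1⟩, ?_, ?_⟩, rfl⟩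
    · exact Subtype.ext (mul_inv_cancel₀ h0)
    · exact Subtype.ext (inv_mul_cancel₀ h0)

end Literature.NumberTheory.EllipticCurves

end
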